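import Mathlib
import Literature.NumberTheory.LFunctions.Zhang2022.Section15ResidueParams
import HarnessLib

/-!
# Zhang (2022) §15 p. 88, "direct calculation" of the residue products — II: the main terms

Topic `Literature/NumberTheory/LFunctions/Zhang2022` (Landau–Siegel audit tree; verdict-neutral).
Y. Zhang, *Discrete mean estimates and the Landau–Siegel zero*, arXiv:2211.02515v1 (2022)
[Zhang2022LandauSiegel] — **an unrefereed manuscript under adjudication** (cell siegel-zhang, D-0069
width campaign). DISCHARGE file (theorems only; no new definitions, no new facts); no statement about
Theorems 1–2 of the manuscript or about Landau–Siegel zeros is made or implied.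

Kernel-checked here: the three identities behind "Hence, by direct calculation, `ℛ₁*ℛ₁₁ = 1 + O(1/𝓛)`,
`ℛ₁*ℛ₁₂ = 2 + O(1/𝓛)`, `ℛ₁*ℛ₁₃ = 1 + O(1/𝓛)`" [Z22 p.88, tex L4385–L4392, DAG `Z22:§15.u060`–`u062`],
namely, with `β₁ = iα(1−5e)`, `β₂ = 2iα(1+e)`, `β₃ = 3iα(1−e)`, `e = c′α𝓛` (2.13) and
`θ = α log P₄ = π + O(1/𝓛)`:
* `mainTerm_one`:   `|β₁β₂P₄^{β₃−β₁}/((β₂−β₁)(β₃−β₁)) − 1| ≤ 24|e| + 2|θ−π| + 2|e||θ|`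
  (`= (1−5e)/(1+7e)·e^{i((2+2e)θ−2π)}`);
* `mainTerm_two`:   `|β₁β₂P₄^{β₃−β₂}/((β₃−β₂)(β₁−β₂)) − 2| ≤ 24|e| + 2|θ−π| + 10|e||θ|`
  (`= 2(1+e)/(1+7e)·e^{i((1−5e)θ−π)}`);
* `mainTerm_three`: `β₁β₂P₄⁰/((β₁−β₃)(β₂−β₃)) = 1` exactly;
* `product_core`: the four-term product estimate that turns the u058/u059 approximations and a
  main-term estimate into `ℛ₁*ℛ₁ⱼ = v + O(1/𝓛)` (cross terms `O(𝓛⁻⁶)` via `1 ≪ |L′(1,χ)| ≪ 𝓛²`).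
-/

noncomputable section

open Complex Real Filter Topology

namespace Literature.NumberTheory.LFunctions.Zhang2022.ResidueValues

open Skeleton

/-! ## The main-term identities `β₁β₂P₄^{β₃−βⱼ}/((β_{j+1}−βⱼ)(β_{j+2}−βⱼ)) = 1, 2, 1 + O(1/𝓛)` -/

section MainTerm

variable (c' : ℝ) {D : ℕ}

/-- **`j = 3`: `β₁β₂ · P₄⁰/((β₁−β₃)(β₂−β₃)) = 1` EXACTLY** (whenever the denominator is non-zero).
[cite: Zhang2022LandauSiegel, §15 p. 88] -/
theorem mainTerm_three (hα : 0 < alpha D) (he : |c' * alpha D * ell D| ≤ 1 / 14) :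
    beta1 c' D * beta2 c' D * ((P4 D : ℝ) : ℂ) ^ (beta3 c' D - beta3 c' D) /
      ((beta1 c' D - beta3 c' D) * (beta2 c' D - beta3 c' D)) = 1 := by
  rw [sub_self, Complex.cpow_zero, mul_one]
  have he' := abs_le.mp he
  have h13 : beta1 c' D - beta3 c' D =
      I * ((alpha D * (-2 - 2 * (c' * alpha D * ell D))) : ℝ) := by
    rw [beta1_eq, beta3_eq]; push_cast; ring
  have h23 : beta2 c' D - beta3 c' D =
      I * ((alpha D * (-1 + 5 * (c' * alpha D * ell D))) : ℝ) := by
    rw [beta2_eq, beta3_eq]; push_cast; ring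
  have hne1 : (alpha D * (-2 - 2 * (c' * alpha D * ell D)) : ℝ) ≠ 0 := by
    refine mul_ne_zero hα.ne' ?_; nlinarith
  have hne2 : (alpha D * (-1 + 5 * (c' * alpha D * ell D)) : ℝ) ≠ 0 := by
    refine mul_ne_zero hα.ne' ?_; nlinarith
  have hden : (beta1 c' D - beta3 c' D) * (beta2 c' D - beta3 c' D) ≠ 0 := by
    rw [h13, h23]
    exact mul_ne_zero (mul_ne_zero Complex.I_ne_zero (Complex.ofReal_ne_zero.mpr hne1))
      (mul_ne_zero Complex.I_ne_zero (Complex.ofReal_ne_zero.mpr hne2))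
  rw [div_eq_one_iff_eq hden, h13, h23, beta1_eq, beta2_eq]
  push_cast
  ring

/-- `‖q e^{iφ} − v‖ ≤ |q − v| + |v||φ|` for real `q, φ, v` (the elementary estimate that turns
`(1−5e)/(1+7e)·e^{iφ}` into `1 + O(|e| + |φ|)`). [cite: Zhang2022LandauSiegel, §15 p. 88] -/
theorem norm_ofReal_mul_exp_sub_le (q φ v : ℝ) :
    ‖(q : ℂ) * Complex.exp (I * (φ : ℂ)) - v‖ ≤ |q - v| + |v| * |φ| := by
  have hE : ‖Complex.exp (I * (φ : ℂ))‖ = 1 := by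
    rw [mul_comm]; exact Complex.norm_exp_ofReal_mul_I φ
  have hE1 : ‖Complex.exp (I * (φ : ℂ)) - 1‖ ≤ |φ| := by
    have h := Real.norm_exp_I_mul_ofReal_sub_one_le (x := φ)
    rw [Real.norm_eq_abs] at h
    exact h
  have hsplit : (q : ℂ) * Complex.exp (I * (φ : ℂ)) - v =
      ((q : ℂ) - v) * Complex.exp (I * (φ : ℂ)) + v * (Complex.exp (I * (φ : ℂ)) - 1) := by ring
  rw [hsplit]
  refine (norm_add_le _ _).trans ?_
  rw [norm_mul, norm_mul, hE, mul_one]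
  have h1 : ‖(q : ℂ) - v‖ = |q - v| := by
    rw [← Complex.ofReal_sub, Complex.norm_real, Real.norm_eq_abs]
  have h2 : ‖(v : ℂ)‖ = |v| := by rw [Complex.norm_real, Real.norm_eq_abs]
  rw [h1, h2]
  gcongr

/-- `P₄^{β₃−β₁} = exp{i((2+2e)θ − 2π)}` with `θ = α log P₄`, `e = c′α𝓛` (using `e^{2πi} = 1`).
[cite: Zhang2022LandauSiegel, §15 p. 88] -/
theorem P4_cpow_beta3_sub_beta1 (hL : 3 ≤ ell D) :
    ((P4 D : ℝ) : ℂ) ^ (beta3 c' D - beta1 c' D) =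
      Complex.exp (I * (((2 + 2 * (c' * alpha D * ell D)) * (alpha D * Real.log (P4 D)) - 2 * π : ℝ) : ℂ)) := by
  have h31 : beta3 c' D - beta1 c' D = I * ((alpha D * (2 + 2 * (c' * alpha D * ell D)) : ℝ) : ℂ) := by
    rw [beta1_eq, beta3_eq]; push_cast; ring
  rw [h31, ofReal_cpow_I_mul (P4_pos hL)]
  have harg : I * (((alpha D * (2 + 2 * (c' * alpha D * ell D))) * Real.log (P4 D) : ℝ) : ℂ) =
      I * (((2 + 2 * (c' * alpha D * ell D)) * (alpha D * Real.log (P4 D)) - 2 * π : ℝ) : ℂ) +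
        2 * π * I := by
    push_cast; ring
  rw [harg, Complex.exp_add, Complex.exp_two_pi_mul_I, mul_one]

/-- `P₄^{β₃−β₂} = −exp{i((1−5e)θ − π)}` (using `e^{πi} = −1`). [cite: Zhang2022LandauSiegel, §15 p. 88] -/
theorem P4_cpow_beta3_sub_beta2 (hL : 3 ≤ ell D) :
    ((P4 D : ℝ) : ℂ) ^ (beta3 c' D - beta2 c' D) =
      -Complex.exp (I * (((1 - 5 * (c' * alpha D * ell D)) * (alpha D * Real.log (P4 D)) - π : ℝ) : ℂ)) := by
  have h32 : beta3 c' D - beta2 c' D = I * ((alpha D * (1 - 5 * (c' * alpha D * ell D)) : ℝ) : ℂ) := by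
    rw [beta2_eq, beta3_eq]; push_cast; ring
  rw [h32, ofReal_cpow_I_mul (P4_pos hL)]
  have harg : I * (((alpha D * (1 - 5 * (c' * alpha D * ell D))) * Real.log (P4 D) : ℝ) : ℂ) =
      I * (((1 - 5 * (c' * alpha D * ell D)) * (alpha D * Real.log (P4 D)) - π : ℝ) : ℂ) +
        π * I := by
    push_cast; ring
  rw [harg, Complex.exp_add, Complex.exp_pi_mul_I, mul_neg_one]

/-- **`j = 1`: `|β₁β₂P₄^{β₃−β₁}/((β₂−β₁)(β₃−β₁)) − 1| ≤ 24|e| + 2|θ − π| + 2|e||θ|`**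
(`e = c′α𝓛`, `θ = α log P₄`; the main term of the "direct calculation" `ℛ₁*ℛ₁₁ = 1 + O(1/𝓛)`).
[cite: Zhang2022LandauSiegel, §15 p. 88] -/
theorem mainTerm_one (hL : 3 ≤ ell D) (he : |c' * alpha D * ell D| ≤ 1 / 14) :
    ‖beta1 c' D * beta2 c' D * ((P4 D : ℝ) : ℂ) ^ (beta3 c' D - beta1 c' D) /
        ((beta2 c' D - beta1 c' D) * (beta3 c' D - beta1 c' D)) - 1‖ ≤
      24 * |c' * alpha D * ell D| + 2 * |alpha D * Real.log (P4 D) - π| +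
        2 * |c' * alpha D * ell D| * |alpha D * Real.log (P4 D)| := by
  have hα := alpha_pos hL
  have he' := abs_le.mp he
  set e : ℝ := c' * alpha D * ell D with he_def
  set θ : ℝ := alpha D * Real.log (P4 D) with hθ_def
  have h21 : beta2 c' D - beta1 c' D = I * ((alpha D * (1 + 7 * e)) : ℝ) := by
    rw [beta1_eq, beta2_eq, ← he_def]; push_cast; ring
  have h31 : beta3 c' D - beta1 c' D = I * ((alpha D * (2 + 2 * e)) : ℝ) := by
    rw [beta1_eq, beta3_eq, ← he_def]; push_cast; ring
  have hne1 : (alpha D * (1 + 7 * e) : ℝ) ≠ 0 := mul_ne_zero hα.ne' (by nlinarith)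
  have hne2 : (alpha D * (2 + 2 * e) : ℝ) ≠ 0 := mul_ne_zero hα.ne' (by nlinarith)
  have hden : (beta2 c' D - beta1 c' D) * (beta3 c' D - beta1 c' D) ≠ 0 := by
    rw [h21, h31]
    exact mul_ne_zero (mul_ne_zero Complex.I_ne_zero (Complex.ofReal_ne_zero.mpr hne1))
      (mul_ne_zero Complex.I_ne_zero (Complex.ofReal_ne_zero.mpr hne2))
  have h7 : (1 + 7 * e : ℝ) ≠ 0 := by nlinarith
  have hQ : beta1 c' D * beta2 c' D / ((beta2 c' D - beta1 c' D) * (beta3 c' D - beta1 c' D)) =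
      (((1 - 5 * e) / (1 + 7 * e) : ℝ) : ℂ) := by
    rw [div_eq_iff hden, h21, h31, beta1_eq, beta2_eq, ← he_def]
    have h7c : ((1 + 7 * e : ℝ) : ℂ) ≠ 0 := Complex.ofReal_ne_zero.mpr h7
    push_cast at h7c ⊢
    rw [div_mul_eq_mul_div, eq_div_iff h7c]
    ring
  rw [mul_div_right_comm, hQ, P4_cpow_beta3_sub_beta1 c' hL, ← he_def, ← hθ_def]
  have hmain := norm_ofReal_mul_exp_sub_le ((1 - 5 * e) / (1 + 7 * e)) ((2 + 2 * e) * θ - 2 * π) 1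
  push_cast at hmain ⊢
  refine hmain.trans ?_
  have hq : |(1 - 5 * e) / (1 + 7 * e) - 1| ≤ 24 * |e| := by
    have hrew : (1 - 5 * e) / (1 + 7 * e) - 1 = -12 * e / (1 + 7 * e) := by
      rw [eq_div_iff h7, sub_mul, div_mul_cancel₀ _ h7]; ring
    rw [hrew, abs_div, abs_mul, abs_of_neg (by norm_num : (-12 : ℝ) < 0)]
    have hlow : 1 / 2 ≤ |1 + 7 * e| := by
      rw [le_abs]; left; linarith
    rw [div_le_iff₀ (by linarith)]
    nlinarith [abs_nonneg e]
  have hφ : |(2 + 2 * e) * θ - 2 * π| ≤ 2 * |θ - π| + 2 * |e| * |θ| := by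
    have hrew : (2 + 2 * e) * θ - 2 * π = 2 * (θ - π) + 2 * (e * θ) := by ring
    rw [hrew]
    refine (abs_add_le _ _).trans ?_
    rw [abs_mul, abs_mul, abs_mul, abs_of_pos (by norm_num : (0 : ℝ) < 2)]
    linarith
  rw [abs_one, one_mul]
  linarith

/-- **`j = 2`: `|β₁β₂P₄^{β₃−β₂}/((β₃−β₂)(β₁−β₂)) − 2| ≤ 24|e| + 2|θ − π| + 10|e||θ|`**
(the main term of `ℛ₁*ℛ₁₂ = 2 + O(1/𝓛)`). [cite: Zhang2022LandauSiegel, §15 p. 88] -/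
theorem mainTerm_two (hL : 3 ≤ ell D) (he : |c' * alpha D * ell D| ≤ 1 / 14) :
    ‖beta1 c' D * beta2 c' D * ((P4 D : ℝ) : ℂ) ^ (beta3 c' D - beta2 c' D) /
        ((beta3 c' D - beta2 c' D) * (beta1 c' D - beta2 c' D)) - 2‖ ≤
      24 * |c' * alpha D * ell D| + 2 * |alpha D * Real.log (P4 D) - π| +
        10 * |c' * alpha D * ell D| * |alpha D * Real.log (P4 D)| := by
  have hα := alpha_pos hL
  have he' := abs_le.mp he
  set e : ℝ := c' * alpha D * ell D with he_def
  set θ : ℝ := alpha D * Real.log (P4 D) with hθ_def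
  have h32 : beta3 c' D - beta2 c' D = I * ((alpha D * (1 - 5 * e)) : ℝ) := by
    rw [beta2_eq, beta3_eq, ← he_def]; push_cast; ring
  have h12 : beta1 c' D - beta2 c' D = I * ((alpha D * (-1 - 7 * e)) : ℝ) := by
    rw [beta1_eq, beta2_eq, ← he_def]; push_cast; ring
  have hne1 : (alpha D * (1 - 5 * e) : ℝ) ≠ 0 := mul_ne_zero hα.ne' (by nlinarith)
  have hne2 : (alpha D * (-1 - 7 * e) : ℝ) ≠ 0 := mul_ne_zero hα.ne' (by nlinarith)
  have hden : (beta3 c' D - beta2 c' D) * (beta1 c' D - beta2 c' D) ≠ 0 := by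
    rw [h32, h12]
    exact mul_ne_zero (mul_ne_zero Complex.I_ne_zero (Complex.ofReal_ne_zero.mpr hne1))
      (mul_ne_zero Complex.I_ne_zero (Complex.ofReal_ne_zero.mpr hne2))
  have h7 : (1 + 7 * e : ℝ) ≠ 0 := by nlinarith
  have h5 : (1 - 5 * e : ℝ) ≠ 0 := by nlinarith
  have hQ : beta1 c' D * beta2 c' D / ((beta3 c' D - beta2 c' D) * (beta1 c' D - beta2 c' D)) =
      ((-(2 + 2 * e) / (1 + 7 * e) : ℝ) : ℂ) := by
    rw [div_eq_iff hden, h32, h12, beta1_eq, beta2_eq, ← he_def]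
    have h7c : ((1 + 7 * e : ℝ) : ℂ) ≠ 0 := Complex.ofReal_ne_zero.mpr h7
    push_cast at h7c ⊢
    rw [div_mul_eq_mul_div, eq_div_iff h7c]
    ring
  rw [mul_div_right_comm, hQ, P4_cpow_beta3_sub_beta2 c' hL, ← he_def, ← hθ_def, mul_neg,
    ← neg_mul, ← Complex.ofReal_neg, neg_div, neg_neg]
  have hmain := norm_ofReal_mul_exp_sub_le ((2 + 2 * e) / (1 + 7 * e)) ((1 - 5 * e) * θ - π) 2
  push_cast at hmain ⊢
  refine hmain.trans ?_
  have hq : |(2 + 2 * e) / (1 + 7 * e) - 2| ≤ 24 * |e| := by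
    have hrew : (2 + 2 * e) / (1 + 7 * e) - 2 = -12 * e / (1 + 7 * e) := by
      rw [eq_div_iff h7, sub_mul, div_mul_cancel₀ _ h7]; ring
    rw [hrew, abs_div, abs_mul, abs_of_neg (by norm_num : (-12 : ℝ) < 0)]
    have hlow : 1 / 2 ≤ |1 + 7 * e| := by
      rw [le_abs]; left; linarith
    rw [div_le_iff₀ (by linarith)]
    nlinarith [abs_nonneg e]
  have hφ : |(1 - 5 * e) * θ - π| ≤ |θ - π| + 5 * |e| * |θ| := by
    have hrew : (1 - 5 * e) * θ - π = (θ - π) + (-5) * (e * θ) := by ring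
    rw [hrew]
    refine (abs_add_le _ _).trans ?_
    rw [abs_mul, abs_mul, abs_of_neg (by norm_num : (-5 : ℝ) < 0)]
    linarith
  rw [show |(2 : ℝ)| = 2 by norm_num]
  linarith

end MainTerm

/-! ## The common core of the three §15 edges -/

section Core

variable (c' : ℝ)

/-- The common quantitative core of the three edges: at a modulus `D` with `𝓛 ≥ 3`,
`|e| ≤ 1/14`, `χ` primitive, given the two approximations of u058/u059 (constants `C₁, C₂ ≥ 0`),
the lower bound `c ≤ |L′(1,χ)|` and a main-term estimate `δ`, the product is within
`C₁C₂ + 4C₁/(π²c) + 64e^{9/2}π²C₂` over `𝓛` plus `δ` of its printed value `v`.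
[cite: Zhang2022LandauSiegel, §15 p. 88] -/
theorem product_core {D : ℕ} [NeZero D] (χ : DirichletCharacter ℂ D) (hL : 3 ≤ ell D)
    (he : |c' * alpha D * ell D| ≤ 1 / 14) (hp : χ.IsPrimitive) {j : ℕ} {r₁ r₂ : ℝ}
    (hk : betaJ c' D (j + 1) - betaJ c' D j = I * ((alpha D * r₁ : ℝ) : ℂ)) (hr₁ : 1 / 2 ≤ |r₁|)
    (hk' : betaJ c' D (j + 2) - betaJ c' D j = I * ((alpha D * r₂ : ℝ) : ℂ)) (hr₂ : 1 / 2 ≤ |r₂|)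
    {R Rstar : ℂ} {C₁ C₂ c δ : ℝ} (hC₁ : 0 ≤ C₁) (hC₂ : 0 ≤ C₂) (hc : 0 < c)
    (hcL : c ≤ ‖deriv χ.LFunction 1‖)
    (h58 : ‖Rstar - beta1 c' D * beta2 c' D * deriv χ.LFunction 1‖ ≤ C₁ / ell D ^ 24)
    (h59 : ‖R - ((P4 D : ℝ) : ℂ) ^ (beta3 c' D - betaJ c' D j) /
        ((betaJ c' D (j + 1) - betaJ c' D j) * (betaJ c' D (j + 2) - betaJ c' D j) *
          deriv χ.LFunction 1)‖ ≤ C₂ / ell D ^ 3)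
    {v : ℂ} (hδ : ‖beta1 c' D * beta2 c' D * ((P4 D : ℝ) : ℂ) ^ (beta3 c' D - betaJ c' D j) /
        ((betaJ c' D (j + 1) - betaJ c' D j) * (betaJ c' D (j + 2) - betaJ c' D j)) - v‖ ≤ δ) :
    ‖Rstar * R - v‖ ≤
      (C₁ * C₂ + 4 * C₁ / (π ^ 2 * c) + 64 * Real.exp (9 / 2) * π ^ 2 * C₂) / ell D + δ := by
  have hℓ : 0 < ell D := by linarith
  have hℓ1 : 1 ≤ ell D := by linarith
  have hα := alpha_pos hL
  have hαeq := Section2.alpha_eq_pi_div_ell9 D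
  set L1 : ℂ := deriv χ.LFunction 1 with hL1
  have hL1ne : L1 ≠ 0 := by
    intro h; rw [h, norm_zero] at hcL; linarith
  -- the denominators
  have hd1 : alpha D / 2 ≤ ‖betaJ c' D (j + 1) - betaJ c' D j‖ := by
    rw [hk]; exact norm_I_mul_ofReal_ge hα hr₁
  have hd2 : alpha D / 2 ≤ ‖betaJ c' D (j + 2) - betaJ c' D j‖ := by
    rw [hk']; exact norm_I_mul_ofReal_ge hα hr₂
  have hd1ne : betaJ c' D (j + 1) - betaJ c' D j ≠ 0 := by
    intro h; rw [h, norm_zero] at hd1; linarith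
  have hd2ne : betaJ c' D (j + 2) - betaJ c' D j ≠ 0 := by
    intro h; rw [h, norm_zero] at hd2; linarith
  set P : ℂ := ((P4 D : ℝ) : ℂ) ^ (beta3 c' D - betaJ c' D j) with hPdef
  have hPn : ‖P‖ = 1 := by
    rw [hPdef, ← betaJ_three]; exact norm_P4_cpow_betaJ_sub c' hL j 3
  set d : ℂ := (betaJ c' D (j + 1) - betaJ c' D j) * (betaJ c' D (j + 2) - betaJ c' D j) with hddef
  have hdne : d ≠ 0 := mul_ne_zero hd1ne hd2ne
  -- sizes of the two main terms
  have hm : ‖beta1 c' D * beta2 c' D * L1‖ ≤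
      8 * alpha D ^ 2 * (2 * Real.exp (9 / 2) * (1 + ell D) * ell D) := by
    rw [norm_mul, norm_mul]
    have h1 := norm_beta1_le c' hL he
    have h2 := norm_beta2_le c' hL he
    have h3 := norm_deriv_LFunction_one_le χ hL hp
    calc ‖beta1 c' D‖ * ‖beta2 c' D‖ * ‖L1‖
        ≤ (2 * alpha D) * (4 * alpha D) * (2 * Real.exp (9 / 2) * (1 + ell D) * ell D) := by
          gcongr
      _ = 8 * alpha D ^ 2 * (2 * Real.exp (9 / 2) * (1 + ell D) * ell D) := by ring
  have hM : ‖P / (d * L1)‖ ≤ 4 / (alpha D ^ 2 * c) := by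
    rw [norm_div, hPn, norm_mul, hddef, norm_mul]
    have hden_ge : alpha D / 2 * (alpha D / 2) * c ≤
        ‖betaJ c' D (j + 1) - betaJ c' D j‖ * ‖betaJ c' D (j + 2) - betaJ c' D j‖ * ‖L1‖ := by
      gcongr
    have hpos : 0 < alpha D / 2 * (alpha D / 2) * c := by positivity
    calc 1 / (‖betaJ c' D (j + 1) - betaJ c' D j‖ * ‖betaJ c' D (j + 2) - betaJ c' D j‖ * ‖L1‖)
        ≤ 1 / (alpha D / 2 * (alpha D / 2) * c) := one_div_le_one_div_of_le hpos hden_ge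
      _ = 4 / (alpha D ^ 2 * c) := by field_simp; ring
  -- the exact cancellation of `L′(1,χ)` in the product of the main terms
  have hmM : beta1 c' D * beta2 c' D * L1 * (P / (d * L1)) =
      beta1 c' D * beta2 c' D * P / d := by
    rw [← mul_div_assoc, show beta1 c' D * beta2 c' D * L1 * P = beta1 c' D * beta2 c' D * P * L1
      by ring, mul_div_mul_right _ _ hL1ne]
  have hδ' : ‖beta1 c' D * beta2 c' D * L1 * (P / (d * L1)) - v‖ ≤ δ := by rw [hmM]; exact hδ
  have hprod := norm_mul_sub_le_of_approx h58 h59 hm hM hδ'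
  refine hprod.trans ?_
  -- bookkeeping: every cross term is `≤ (its constant)/𝓛`
  have hα2 : alpha D ^ 2 = π ^ 2 / ell D ^ 18 := by rw [hαeq]; ring
  have hT1 : C₁ / ell D ^ 24 * (C₂ / ell D ^ 3) ≤ C₁ * C₂ / ell D := by
    rw [div_mul_div_comm, ← pow_add, div_le_div_iff₀ (by positivity) hℓ]
    have : ell D ≤ ell D ^ (24 + 3) := by
      calc ell D = ell D ^ 1 := (pow_one _).symm
        _ ≤ ell D ^ (24 + 3) := pow_le_pow_right₀ hℓ1 (by norm_num)
    nlinarith [mul_nonneg hC₁ hC₂]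
  have hT2 : C₁ / ell D ^ 24 * (4 / (alpha D ^ 2 * c)) ≤ 4 * C₁ / (π ^ 2 * c) / ell D := by
    rw [hα2]
    have hπ : 0 < π ^ 2 := by positivity
    rw [show C₁ / ell D ^ 24 * (4 / (π ^ 2 / ell D ^ 18 * c)) = 4 * C₁ / (π ^ 2 * c) / ell D ^ 6 by
      field_simp]
    rw [div_le_div_iff₀ (by positivity) hℓ]
    have h6 : ell D ≤ ell D ^ 6 := by
      calc ell D = ell D ^ 1 := (pow_one _).symm
        _ ≤ ell D ^ 6 := pow_le_pow_right₀ hℓ1 (by norm_num)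
    have hnn : 0 ≤ 4 * C₁ / (π ^ 2 * c) := by positivity
    exact mul_le_mul_of_nonneg_left h6 hnn
  have hT3 : 8 * alpha D ^ 2 * (2 * Real.exp (9 / 2) * (1 + ell D) * ell D) * (C₂ / ell D ^ 3) ≤
      64 * Real.exp (9 / 2) * π ^ 2 * C₂ / ell D := by
    rw [hα2]
    rw [show 8 * (π ^ 2 / ell D ^ 18) * (2 * Real.exp (9 / 2) * (1 + ell D) * ell D) * (C₂ / ell D ^ 3)
        = 16 * Real.exp (9 / 2) * π ^ 2 * C₂ * ((1 + ell D) * ell D) / ell D ^ 21 by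
      field_simp; ring]
    rw [div_le_div_iff₀ (by positivity) hℓ]
    have h21 : (1 + ell D) * ell D * ell D ≤ 4 * ell D ^ 21 := by
      have h3 : ell D ^ 3 ≤ ell D ^ 21 := pow_le_pow_right₀ hℓ1 (by norm_num)
      nlinarith [pow_pos hℓ 2, pow_pos hℓ 3]
    have hnn : 0 ≤ 16 * Real.exp (9 / 2) * π ^ 2 * C₂ := by positivity
    nlinarith
  have hsum : C₁ / ell D ^ 24 * (C₂ / ell D ^ 3) + C₁ / ell D ^ 24 * (4 / (alpha D ^ 2 * c)) +
      8 * alpha D ^ 2 * (2 * Real.exp (9 / 2) * (1 + ell D) * ell D) * (C₂ / ell D ^ 3) + δ ≤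
      (C₁ * C₂ + 4 * C₁ / (π ^ 2 * c) + 64 * Real.exp (9 / 2) * π ^ 2 * C₂) / ell D + δ := by
    rw [add_div, add_div]
    linarith
  exact hsum

end Core

end Literature.NumberTheory.LFunctions.Zhang2022.ResidueValues
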